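import Mathlib.Analysis.InnerProductSpace.Calculus
import Literature.Geometry.Lorentzian.ChartCurvature
import Literature.Geometry.Lorentzian.LeviCivitaCurvature
import Literature.Geometry.Riemannian.ConstantCurvature
import HarnessLib

/-!
# Hyperbolic space in the graph chart of the hyperboloid model has constant curvature `-1`

Topic `Geometry/Riemannian`; namespace `Literature.Geometry.Riemannian.Hyperboloid` (the sub-namespace
names the model). Everything here is PROVED; the file introduces no named fact.

Lee, *Introduction to Riemannian Manifolds* (2nd ed.), Thm. 3.7 (a): hyperbolic space `ℍⁿ = ℍⁿ(1)` is
the upper sheet `{τ > 0}` of `|ξ|² - τ² = -1` in Minkowski space `ℝ^{n,1}` with the induced metric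
`ι^* q̄`, `q̄ = ∑ (dξⁱ)² - dτ²`; Thm. 8.34 (c) (with Problem 8-28 (a): second fundamental form + Gauss
equation): `ℍⁿ(R)` has constant sectional curvature `-1/R²`; Prop. 8.36: constant sectional
curvature `c` means `Rm = c (g ∧ g)`, i.e. `R(v, w)x = c(⟨w, x⟩v - ⟨v, x⟩w)`.

We realise `ℍⁿ` on ONE global chart: the upper sheet is the graph `τ = √(1 + |ξ|²)` over `ℝⁿ`, and
in the graph parametrisation `φ(u) = (u, √(1 + |u|²))` of an arbitrary real inner product space `V`
(so `n = dim V`) the induced metric has components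
`G_u(v, w) = q̄(dφ_u v, dφ_u w) = ⟪v, w⟫ - ⟪u, v⟫⟪u, w⟫ / (1 + ‖u‖²)` (`comp`, `comp_eq_pullback`).

* `Hyperboloid.comp u` — these components, a smooth (`contDiff_comp`) family of symmetric positive
  definite (`comp_pos`: `G_u(v,v) ≥ ‖v‖²/(1+‖u‖²)`) bilinear forms on `V`;
* `Hyperboloid.metric U` — **the hyperbolic metric** on any open subset `U ⊆ V` (an `Opens V` with
  Mathlib's one-chart manifold structure): a `C^∞` Riemannian `PseudoRiemannianMetric` with
  `(metric U).val y = comp y`; `U = ⊤` is all of `ℍⁿ`;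
* `christoffel_eq` — its Christoffel symbols `Γ_u(X, Y) = -G_u(X, Y) u` (`Γᵏᵢⱼ = -gᵢⱼ uᵏ`), from the
  Koszul form `K(X, Y, Z) = -2 G(X,Y) ⟪u,Z⟫/(1+‖u‖²)` (`koszulForm_comp`) and the chart calculus of
  `ChartCalculus.lean` (O'Neill 1983, Ch. 3, Prop. 3.13);
* `curvature_leviCivita_eq` — **`R(X, Y)Z = -(G(Y,Z) X - G(X,Z) Y)`** for the Levi-Civita connection
  (coordinate formula `R = ∂Γ - ∂Γ + ΓΓ - ΓΓ`, `ChartCurvature.curvatureAux_const`, O'Neill 1983,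
  Ch. 3, Lemma 3.38; the `u`-component cancels identically);
* `hasConstantSectionalCurvature` — **`(U, metric U)` has constant sectional curvature `-1`** in the
  tree's sense (`PseudoRiemannianMetric.HasConstantSectionalCurvature`, `ConstantCurvature.lean`:
  for EVERY torsion-free compatible covariant derivative, via `IsLeviCivita.curvature_eq_riemann`).

This is the local model for closed / finite-volume hyperbolic manifolds (e.g. the facts
`Literature.Topology.FourManifolds.Davis1985_exists_closed_hyperbolic_four`,
`…exists_fiveTori_hyperbolic_complement_sphereFour`), whose isometries are restrictions of the
LINEAR group `O⁺(n,1)` in this model. Not here: the isometry group, geodesics, completeness, the other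
models of Thm. 3.7 and the isometries between them.

## References

* J. M. Lee, *Introduction to Riemannian Manifolds*, 2nd ed., Springer GTM 176 (2018): Thm. 3.7 (a)
  (hyperboloid model), Thm. 8.34 (c) and Problem 8-28 (curvature `-1/R²`), Prop. 8.36. [`Lee2018`]
* B. O'Neill, *Semi-Riemannian geometry*, Academic Press 1983, Ch. 3, Prop. 3.13, Lemma 3.38;
  Ch. 4, pp. 108–113 (hyperquadrics). [`ONeill1983`]
-/

noncomputable section

open Bundle Set TopologicalSpace
open scoped Manifold ContDiff Topology RealInnerProductSpace

namespace Literature.Geometry.Riemannian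

namespace Hyperboloid

-- instance search through the nested operator type `V →L[ℝ] V →L[ℝ] ℝ` of the metric components
set_option maxSynthPendingDepth 3

section Weight

variable {V : Type*} [NormedAddCommGroup V]

/-- The weight `w(u) = (1 + ‖u‖²)⁻¹ = 1/τ²` of the graph chart (`τ = √(1 + |ξ|²)` on the upper
sheet, Lee 2018, Thm. 3.7 (a)). [cite: Lee2018, Thm. 3.7 (a)] -/
def weight (u : V) : ℝ := (1 + ‖u‖ ^ 2)⁻¹

/-- `1 + ‖u‖² > 0`. [folklore] -/
theorem one_add_norm_sq_pos (u : V) : 0 < 1 + ‖u‖ ^ 2 := by positivity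

/-- `w(u) > 0`. [folklore] -/
theorem weight_pos (u : V) : 0 < weight u := inv_pos.2 (one_add_norm_sq_pos u)

/-- `w(u) (1 + ‖u‖²) = 1`. [folklore] -/
theorem weight_mul_one_add (u : V) : weight u * (1 + ‖u‖ ^ 2) = 1 :=
  inv_mul_cancel₀ (one_add_norm_sq_pos u).ne'

end Weight

variable {V : Type*} [NormedAddCommGroup V] [InnerProductSpace ℝ V]

/-- The Euclidean inner product of `V` as an honestly bilinear continuous map (Mathlib's `innerSL ℝ`,
whose type is semilinear). [folklore] -/
def dot : V →L[ℝ] V →L[ℝ] ℝ := (innerSL ℝ : V →L[ℝ] V →L[ℝ] ℝ)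

/-- `dot v w = ⟪v, w⟫`. [folklore] -/
@[simp] theorem dot_apply (v w : V) : dot v w = ⟪v, w⟫ := innerSL_apply_apply ℝ v w

/-- The rank-one form `dτ ⊗ dτ` up to the factor `τ²`: `(v, w) ↦ ⟪u, v⟫ ⟪u, w⟫`. [folklore] -/
def rankOne (u : V) : V →L[ℝ] V →L[ℝ] ℝ := (dot u).smulRight (dot u)

/-- `rankOne u v w = ⟪u, v⟫ ⟪u, w⟫`. [folklore] -/
@[simp] theorem rankOne_apply (u v w : V) : rankOne u v w = ⟪u, v⟫ * ⟪u, w⟫ := by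
  simp [rankOne, ContinuousLinearMap.smulRight_apply]

/-- **The components of the hyperbolic metric in the graph chart of the hyperboloid model**:
`G_u(v, w) = ⟪v, w⟫ - ⟪u, v⟫ ⟪u, w⟫ / (1 + ‖u‖²)`, the pullback of the Minkowski metric
`∑ (dξⁱ)² - dτ²` along `u ↦ (u, √(1 + ‖u‖²))` (`comp_eq_pullback`; Lee 2018, Thm. 3.7 (a), `ι^* q̄`).
[cite: Lee2018, Thm. 3.7 (a)] -/
def comp (u : V) : V →L[ℝ] V →L[ℝ] ℝ := dot - weight u • rankOne u

/-- `G_u(v, w) = ⟪v, w⟫ - w(u) ⟪u, v⟫ ⟪u, w⟫`. [cite: Lee2018, Thm. 3.7 (a)] -/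
theorem comp_apply (u v w : V) : comp u v w = ⟪v, w⟫ - weight u * (⟪u, v⟫ * ⟪u, w⟫) := by
  simp [comp]

/-- **Faithfulness to the hyperboloid model.** With `τ(u) = √(1 + ‖u‖²)`, the differential of the
graph parametrisation `φ(u) = (u, τ(u))` is `dφ_u v = (v, ⟪u, v⟫/τ)`, and
`G_u(v, w) = ⟪v, w⟫ - (⟪u, v⟫/τ)(⟪u, w⟫/τ) = q̄(dφ_u v, dφ_u w)`: `comp` IS the induced metric
`ι^* q̄` of Lee 2018, Thm. 3.7 (a) (`R = 1`) read in the chart `ξ`. [cite: Lee2018, Thm. 3.7 (a)] -/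
theorem comp_eq_pullback (u v w : V) :
    comp u v w = ⟪v, w⟫ - (⟪u, v⟫ / √(1 + ‖u‖ ^ 2)) * (⟪u, w⟫ / √(1 + ‖u‖ ^ 2)) := by
  rw [comp_apply, div_mul_div_comm, ← pow_two, Real.sq_sqrt (one_add_norm_sq_pos u).le, weight]
  ring

/-- `G_u` is symmetric. [folklore] -/
theorem comp_symm (u v w : V) : comp u v w = comp u w v := by
  rw [comp_apply, comp_apply, real_inner_comm v w, mul_comm ⟪u, v⟫]

/-- `G_u(v, v) ≥ ‖v‖² / (1 + ‖u‖²)` (Cauchy–Schwarz), the positivity behind "`ℍⁿ` is a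
pseudo-Riemannian submanifold of signature `(n, 0)`" (Lee 2018, proof of Thm. 3.7). [cite: Lee2018, Thm. 3.7] -/
theorem weight_mul_norm_sq_le_comp (u v : V) : weight u * ‖v‖ ^ 2 ≤ comp u v v := by
  rw [comp_apply, real_inner_self_eq_norm_sq]
  have hcs : ⟪u, v⟫ * ⟪u, v⟫ ≤ ‖u‖ ^ 2 * ‖v‖ ^ 2 := by
    have h := abs_real_inner_le_norm u v
    have h0 : 0 ≤ |⟪u, v⟫| := abs_nonneg _
    calc ⟪u, v⟫ * ⟪u, v⟫ = |⟪u, v⟫| * |⟪u, v⟫| := (abs_mul_abs_self _).symm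
      _ ≤ (‖u‖ * ‖v‖) * (‖u‖ * ‖v‖) := mul_le_mul h h h0 (by positivity)
      _ = ‖u‖ ^ 2 * ‖v‖ ^ 2 := by ring
  have hw := weight_pos u
  have hw1 := weight_mul_one_add u
  nlinarith [mul_le_mul_of_nonneg_left hcs hw.le]

/-- `G_u` is positive definite. [cite: Lee2018, Thm. 3.7] -/
theorem comp_pos (u : V) {v : V} (hv : v ≠ 0) : 0 < comp u v v :=
  lt_of_lt_of_le (mul_pos (weight_pos u) (by positivity)) (weight_mul_norm_sq_le_comp u v)

/-- `G_u(u, w) = w(u) ⟪u, w⟫`. [folklore] -/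
theorem comp_self_left (u w : V) : comp u u w = weight u * ⟪u, w⟫ := by
  rw [comp_apply, real_inner_self_eq_norm_sq]
  have h := weight_mul_one_add u
  linear_combination (-⟪u, w⟫) * h

/-- `G_u(v, u) = w(u) ⟪u, v⟫`. [folklore] -/
theorem comp_self_right (u v : V) : comp u v u = weight u * ⟪u, v⟫ := by
  rw [comp_symm, comp_self_left]

/-! ### Smoothness and first derivatives of the components -/

/-- `u ↦ w(u)` is smooth. [folklore] -/
theorem contDiff_weight : ContDiff ℝ ∞ (weight : V → ℝ) := by
  unfold weight
  exact (contDiff_const.add (contDiff_norm_sq ℝ)).inv fun u ↦ (one_add_norm_sq_pos u).ne'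

/-- `u ↦ ⟪u, ·⟫ ⊗ ⟪u, ·⟫` is smooth (a continuous bilinear map of `(⟪u, ·⟫, ⟪u, ·⟫)`). [folklore] -/
theorem contDiff_rankOne : ContDiff ℝ ∞ (rankOne : V → V →L[ℝ] V →L[ℝ] ℝ) :=
  ((ContinuousLinearMap.smulRightL ℝ V (V →L[ℝ] ℝ)).isBoundedBilinearMap.contDiff (n := ∞)).comp
    ((dot (V := V)).contDiff.prodMk (dot (V := V)).contDiff)

/-- **The components `G` are smooth on `V`.** [folklore] -/
theorem contDiff_comp : ContDiff ℝ ∞ (comp : V → V →L[ℝ] V →L[ℝ] ℝ) :=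
  contDiff_const.sub (contDiff_weight.smul contDiff_rankOne)

/-- `G` is differentiable at every point. [folklore] -/
theorem differentiableAt_comp (u : V) : DifferentiableAt ℝ (comp : V → V →L[ℝ] V →L[ℝ] ℝ) u :=
  contDiff_comp.differentiable (by simp) u

/-- `Dw(u) = -2 w(u)² ⟪u, ·⟫`. [folklore] -/
theorem hasFDerivAt_weight (u : V) :
    HasFDerivAt (weight : V → ℝ) (-(2 * weight u ^ 2) • dot u) u := by
  have h1 : HasFDerivAt (fun y : V ↦ 1 + ‖y‖ ^ 2) (2 • (innerSL ℝ u : V →L[ℝ] ℝ)) u :=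
    (hasStrictFDerivAt_norm_sq u).hasFDerivAt.const_add 1
  have h2 := (hasDerivAt_inv (one_add_norm_sq_pos u).ne').comp_hasFDerivAt u h1
  have h3 : (-((1 + ‖u‖ ^ 2) ^ 2)⁻¹) • (2 • (innerSL ℝ u : V →L[ℝ] ℝ)) =
      -(2 * weight u ^ 2) • dot u := by
    ext v
    simp only [FunLike.coe_smul, Pi.smul_apply, smul_eq_mul, innerSL_apply_apply, dot_apply,
      weight, inv_pow]
    ring
  rw [← h3]
  exact h2

/-- **First derivatives of the metric components**:
`∂_{X₀} G(Y₀, Z₀)(u) = 2 w² ⟪u,X₀⟫⟪u,Y₀⟫⟪u,Z₀⟫ - w (⟪X₀,Y₀⟫⟪u,Z₀⟫ + ⟪u,Y₀⟫⟪X₀,Z₀⟫)`. [folklore] -/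
theorem fderiv_comp_apply (u X₀ Y₀ Z₀ : V) :
    fderiv ℝ comp u X₀ Y₀ Z₀ =
      2 * weight u ^ 2 * ⟪u, X₀⟫ * ⟪u, Y₀⟫ * ⟪u, Z₀⟫
        - weight u * (⟪X₀, Y₀⟫ * ⟪u, Z₀⟫ + ⟪u, Y₀⟫ * ⟪X₀, Z₀⟫) := by
  rw [← Literature.Geometry.Lorentzian.OpensChart.fderiv_apply₂ comp (differentiableAt_comp u)]
  have hF : (fun y : V ↦ comp y Y₀ Z₀) = fun y ↦ ⟪Y₀, Z₀⟫ - weight y * (dot Y₀ y * dot Z₀ y) := by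
    funext y
    rw [comp_apply, dot_apply, dot_apply, real_inner_comm Y₀ y, real_inner_comm Z₀ y]
  have h : HasFDerivAt (fun y : V ↦ ⟪Y₀, Z₀⟫ - weight y * (dot Y₀ y * dot Z₀ y))
      (-(weight u • ((dot Y₀ u) • dot Z₀ + (dot Z₀ u) • dot Y₀)
          + (dot Y₀ u * dot Z₀ u) • (-(2 * weight u ^ 2) • dot u))) u :=
    ((hasFDerivAt_weight u).mul
      ((dot Y₀).hasFDerivAt.mul (dot Z₀).hasFDerivAt)).const_sub ⟪Y₀, Z₀⟫
  rw [hF, h.fderiv]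
  simp only [neg_apply, add_apply, FunLike.coe_smul, Pi.smul_apply, smul_eq_mul, dot_apply,
    real_inner_comm X₀ Y₀, real_inner_comm X₀ Z₀, real_inner_comm u Y₀, real_inner_comm u Z₀]
  ring

open Literature.Geometry.Lorentzian.OpensChart in
/-- **The Koszul form of the components** (`ChartCalculus.koszulForm`: `∂_X G(Y,Z) + ∂_Y G(Z,X) -
∂_Z G(X,Y)`): `K(X₀, Y₀, Z₀) = -2 w ⟪u, Z₀⟫ G_u(X₀, Y₀)` — the cubic terms cancel. O'Neill 1983,
Ch. 3, Prop. 3.13 (`2 Γ_{ijm} = ∂ᵢ g_{jm} + ∂ⱼ g_{im} - ∂ₘ g_{ij}`). [cite: ONeill1983, Ch. 3, Prop. 3.13] -/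
theorem koszulForm_comp (u X₀ Y₀ Z₀ : V) :
    koszulForm comp u Y₀ X₀ Z₀ = -(2 * weight u * ⟪u, Z₀⟫ * comp u X₀ Y₀) := by
  rw [koszulForm_apply, fderiv_comp_apply, fderiv_comp_apply, fderiv_comp_apply, comp_apply,
    real_inner_comm X₀ Y₀, real_inner_comm X₀ Z₀, real_inner_comm Y₀ Z₀]
  ring

/-! ### The hyperbolic metric on an open subset of `V` -/

variable (U : Opens V)

open Literature.Geometry.Lorentzian in
/-- **The hyperbolic metric** (curvature `-1`) in the graph chart of the hyperboloid model, on an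
open subset `U ⊆ V` of a real inner product space regarded as a manifold with its single chart
(`U = ⊤`: all of `ℍⁿ`, `n = dim V`): the `C^∞` Riemannian pseudo-Riemannian metric on `TU` with
components `comp` (smoothness through `OpensChart.contMDiffAt_bilinSection_iff`). Lee 2018,
Thm. 3.7 (a) (`ℍⁿ(1) ⊂ ℝ^{n,1}` with `ι^* q̄`), in the chart `ξ` of the upper sheet.
[cite: Lee2018, Thm. 3.7 (a)] -/
def metric : PseudoRiemannianMetric 𝓘(ℝ, V) ∞ V (TangentSpace 𝓘(ℝ, V) : U → Type _) where
  val y := comp (V := V) y.1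
  symm y v w := comp_symm (V := V) y.1 v w
  nondegenerate y v hv := by
    by_contra h
    exact (comp_pos (V := V) y.1 h).ne' (hv v)
  contMDiff y :=
    (OpensChart.contMDiffAt_bilinSection_iff y _ comp (fun _ ↦ rfl)).2 contDiff_comp.contDiffAt

variable {U}

/-- The hyperbolic metric has components `comp`: `(metric U)_y = G_y`. [cite: Lee2018, Thm. 3.7 (a)] -/
theorem metric_val (y : U) : (metric U).val y = comp (V := V) y.1 := rfl

/-- **The hyperbolic metric is Riemannian** (Lee 2018, proof of Thm. 3.7: signature `(n, 0)`).
[cite: Lee2018, Thm. 3.7] -/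
theorem isRiemannian_metric : (metric U).IsRiemannian := fun y _ hv ↦ comp_pos (V := V) y.1 hv

/-! ### Christoffel symbols and curvature -/

section Curvature

open Literature.Geometry.Lorentzian Literature.Geometry.Lorentzian.OpensChart
  Literature.Geometry.Lorentzian.PseudoRiemannianMetric

variable [FiniteDimensional ℝ V]

/-- **The Christoffel symbols of the hyperboloid chart**: `Γ_y(X₀, Y₀) = -G_y(X₀, Y₀) y`, i.e.
`Γᵏᵢⱼ = -gᵢⱼ yᵏ` (`OpensChart.christoffel`, characterised by `2 g(Γ(X,Y), Z) = K(X,Y,Z)`,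
O'Neill 1983, Ch. 3, Prop. 3.13; here `2 G(-G(X,Y) y, Z) = -2 G(X,Y) w ⟪y,Z⟫ = K(X,Y,Z)` by
`koszulForm_comp` and `G_y(y, Z) = w ⟪y, Z⟫`). [cite: ONeill1983, Ch. 3, Prop. 3.13] -/
theorem christoffel_eq (y : U) (Y₀ X₀ : V) :
    christoffel (metric U) comp y Y₀ X₀ = -(comp (V := V) y.1 X₀ Y₀) • (y : V) := by
  rw [christoffel_apply]
  refine (metric U).sharp_eq_of_forall y _ _ fun w ↦ ?_
  change comp (V := V) y.1 (-(comp (V := V) y.1 X₀ Y₀) • (y : V)) (show V from w) =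
    2⁻¹ * koszulForm comp (y : V) Y₀ X₀ (show V from w)
  rw [map_smul, koszulForm_comp, FunLike.coe_smul, Pi.smul_apply, smul_eq_mul,
    comp_self_left (y : V) (show V from w)]
  ring

omit [FiniteDimensional ℝ V] in
/-- Linear-algebra step of the curvature computation: collecting the multiples of the position
vector `x`, whose total coefficient vanishes. [folklore] -/
theorem smul_combination_aux (x X Y : V) (a₁ a₂ b₁ b₂ c₁ c₂ : ℝ)
    (h : -a₁ + b₁ * c₁ + a₂ - b₂ * c₂ = 0) :
    -(b₁ • X) + -(a₁ • x) + (b₁ * c₁) • x - (-(b₂ • Y) + -(a₂ • x) + (b₂ * c₂) • x) =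
      -(b₁ • X) + b₂ • Y := by
  have e : -(b₁ • X) + -(a₁ • x) + (b₁ * c₁) • x - (-(b₂ • Y) + -(a₂ • x) + (b₂ * c₂) • x) =
      (-a₁ + b₁ * c₁ + a₂ - b₂ * c₂) • x + (-(b₁ • X) + b₂ • Y) := by
    module
  rw [e, h, zero_smul, zero_add]

variable [CompleteSpace V]

/-- **The curvature tensor of the hyperbolic metric**: for the Levi-Civita connection of
`metric U` and tangent vectors `X₀, Y₀, Z₀` at `x`,
`R(X₀, Y₀) Z₀ = -(G_x(Y₀, Z₀) X₀ - G_x(X₀, Z₀) Y₀)` — Lee 2018, Thm. 8.34 (c) with Prop. 8.36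
(`R(v, w)x = c(⟨w, x⟩v - ⟨v, x⟩w)`, `c = -1`). Proof: the coordinate formula
`R(X,Y)Z = ∂_X Γ(Y,Z) + Γ(X, Γ(Y,Z)) - ∂_Y Γ(X,Z) - Γ(Y, Γ(X,Z))` (`curvatureAux_const`,
O'Neill 1983, Ch. 3, Lemma 3.38) with `Γ(X, Y) = -G(X,Y) x` (`christoffel_eq`); the coefficient of
`x` is `-∂_X G(Y,Z) + ∂_Y G(X,Z) + G(Y,Z) G(X,x) - G(X,Z) G(Y,x) = 0` (`fderiv_comp_apply`).
The instance argument is supplied by `(metric U).hasLeviCivita`. [cite: Lee2018, Thm. 8.34 (c)] -/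
theorem curvature_leviCivita_eq [(metric U).HasLeviCivita] (x : U) (X₀ Y₀ Z₀ : V) :
    ((metric U).leviCivita.curvature x X₀ Y₀ Z₀ : V) =
      -(comp (V := V) x.1 Y₀ Z₀) • X₀ + (comp (V := V) x.1 X₀ Z₀) • Y₀ := by
  have h2 : (2 : ℕ∞ω) ≤ ∞ := WithTop.coe_le_coe.mpr le_top
  have hG : ∀ y : U, (metric U).val y = comp (V := V) y.1 := fun _ ↦ rfl
  have hGd : ∀ y : U, DifferentiableAt ℝ comp (y : V) := fun y ↦ differentiableAt_comp (y : V)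
  have hc : ∀ A B : V, DifferentiableAt ℝ (fun y : V ↦ comp y A B) x := fun A B ↦
    differentiableAt_apply₂ comp (differentiableAt_comp (x : V)) A B
  have hΓd : ∀ A B : V, HasFDerivAt (fun y : V ↦ -(comp y A B) • y)
      (-(comp (x : V) A B) • ContinuousLinearMap.id ℝ V +
        (-(fderiv ℝ (fun y : V ↦ comp y A B) x)).smulRight (x : V)) x := fun A B ↦
    (hc A B).hasFDerivAt.neg.smul (hasFDerivAt_id (x : V))
  rw [curvature_leviCivita_eq_curvatureAux_const (g := metric U) h2 x X₀ Y₀ Z₀,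
    curvatureAux_const hG hGd (Γc := fun (y' : V) (A' B' : V) ↦ -(comp y' B' A') • y')
      (christoffel_eq (U := U)) x X₀ Y₀ Z₀ (hΓd Y₀ Z₀).differentiableAt
      (hΓd X₀ Z₀).differentiableAt,
    (hΓd Y₀ Z₀).fderiv, (hΓd X₀ Z₀).fderiv]
  simp only [add_apply, FunLike.coe_smul, Pi.smul_apply, ContinuousLinearMap.id_apply,
    ContinuousLinearMap.smulRight_apply, neg_apply, map_neg, map_smul, smul_eq_mul, neg_smul,
    neg_neg, fderiv_apply₂ comp (differentiableAt_comp (x : V)), fderiv_comp_apply, comp_self_right]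
  have key : -(2 * weight (x : V) ^ 2 * ⟪(x : V), X₀⟫ * ⟪(x : V), Y₀⟫ * ⟪(x : V), Z₀⟫
        - weight (x : V) * (⟪X₀, Y₀⟫ * ⟪(x : V), Z₀⟫ + ⟪(x : V), Y₀⟫ * ⟪X₀, Z₀⟫))
      + comp (x : V) Y₀ Z₀ * (weight (x : V) * ⟪(x : V), X₀⟫)
      + (2 * weight (x : V) ^ 2 * ⟪(x : V), Y₀⟫ * ⟪(x : V), X₀⟫ * ⟪(x : V), Z₀⟫
        - weight (x : V) * (⟪Y₀, X₀⟫ * ⟪(x : V), Z₀⟫ + ⟪(x : V), X₀⟫ * ⟪Y₀, Z₀⟫))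
      - comp (x : V) X₀ Z₀ * (weight (x : V) * ⟪(x : V), Y₀⟫) = 0 := by
    rw [comp_apply, comp_apply, real_inner_comm X₀ Y₀]
    ring
  exact smul_combination_aux (x : V) X₀ Y₀ _ _ _ _ _ _ key

/-- **Constant sectional curvature `-1` for the Levi-Civita connection**:
`Rm(X, Y, Z, W) = g(R(X,Y)Z, W) = -(g(Y,Z) g(X,W) - g(X,Z) g(Y,W))`
(`HasConstantSectionalCurvatureWith`, Lee 2018, Prop. 8.36 and Thm. 8.34 (c)).
[cite: Lee2018, Thm. 8.34 (c)] -/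
theorem hasConstantSectionalCurvatureWith_leviCivita [(metric U).HasLeviCivita] :
    (metric U).HasConstantSectionalCurvatureWith (metric U).leviCivita (-1) := by
  intro x X Y Z W
  rw [curvatureForm]
  change comp (V := V) x.1 ((metric U).leviCivita.curvature x X Y Z) W =
    -1 * (comp (V := V) x.1 Y Z * comp (V := V) x.1 X W -
      comp (V := V) x.1 X Z * comp (V := V) x.1 Y W)
  rw [curvature_leviCivita_eq x X Y Z, map_add, map_smul, map_smul]
  simp only [add_apply, FunLike.coe_smul, Pi.smul_apply, smul_eq_mul]
  ring

/-- **Hyperbolic space has constant sectional curvature `-1`** (Lee 2018, Thm. 8.34 (c), `R = 1`),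
in the tree's hypothesis-free sense: every torsion-free `g`-compatible covariant derivative of the
hyperbolic metric on `U ⊆ V` has `Rm = -(g ∧ g)/2`, i.e. `R(X,Y)Z = -(g(Y,Z)X - g(X,Z)Y)`
(Prop. 8.36) — by `hasConstantSectionalCurvatureWith_leviCivita` and uniqueness of the Levi-Civita
connection on differentiable fields (`IsLeviCivita.curvature_eq_riemann`). [cite: Lee2018, Thm. 8.34 (c)] -/
theorem hasConstantSectionalCurvature : (metric U).HasConstantSectionalCurvature (-1) := by
  intro cov hcov
  haveI := (metric U).hasLeviCivita
  have h2 : (2 : ℕ∞ω) ≤ ∞ := WithTop.coe_le_coe.mpr le_top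
  intro x X Y Z W
  rw [curvatureForm, hcov.curvature_eq_riemann h2 x]
  exact hasConstantSectionalCurvatureWith_leviCivita x X Y Z W

end Curvature

end Hyperboloid

end Literature.Geometry.Riemannian
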